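import Mathlib
import Summits.KontsevichZagierPeriods.Zeta5Search.LaiKappa3Assembly
import Summits.KontsevichZagierPeriods.Zeta5Search.LaiSavingCells
import HarnessLib

/-!
# 'κ₃ ≤ 73' from ONE finite certificate: an admissible cell table with truncated rate `≥ 38700`

Sub-problem `KontsevichZagierPeriods/Zeta5Search`, family `fam-indep` (linear independence /
dimension), generation 5. Systematic search; no irrationality claim unless certified.

Composition of the conditional assembly `kappa3_three_le_oddZetaSpanRank_of_savingRate`
(`LaiKappa3Assembly.lean`: every field of `LaiBoxInputs 74 2180 444 δ74 36` except the saving rate) with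
the rate theorem for finite cell tables `tendsto_log_laiPhiGen_cellExp_div` (`LaiSavingCells.lean`: the
saving rate of a finite cell table EXISTS and equals `cellRate T`, with computable rational bounds
`cellRateTrunc T K ≤ cellRate T ≤ cellRateUB T`, and admissibility cell by cell). Result:

* `Kappa3CellCert` — the data of a certificate: a list `T` of cells `[u, v) ⊂ [1/434, 1]` with exponents,
  pairwise disjoint, each ADMISSIBLE (`SavingCell.Adm 74 2180 444 δ74 5`: its exponent is `≤` the brick
  exponent `laiPhiDiv 74 2180 444 n δ74 k p` on its class), with `38700 ≤ cellRateTrunc T K` and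
  `cellRateUB T ≤ 80000` (two decidable rational inequalities);
* `kappa3_three_le_oddZetaSpanRank_of_cellCert` — **any such certificate gives `3 ≤ oddZetaSpanRank 36`**
  ('κ₃ ≤ 73': `dim_ℚ Span(1, ζ(3), ζ(5), …, ζ(73)) ≥ 3`), and `…_le_of_cellCert` the ladder reading for
  every `m' ≥ 36`.

WHAT THIS CHANGES: the open input is no longer a limit statement about the full table (the minimum of
`φ̃(n/p, ·)`: a step function of `{n/p}` with ≈ 3·10⁵ pieces at this point, `ϖ̃ = 38764.19…` by the
`zeta5-calc` lane, uncertified; the shape of [Lai2024BallRivoal, Lemma 5.3]) but the existence of ONE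
finite object checkable by computation: cells, exponents, per-cell admissibility (a
two-variable floor inequality on a rational box — the kind of check `Literature/…/ZudilinPhi.lean` certifies
by `decide +kernel` for Zudilin's `φ₀`), and two rational sums. The room is `ϖ̃ − 38700 ≈ 64` nats for the
losses of coarsening (`c =` the minimum of `φ` on the cell) and truncation (`k < K`). HONEST FRAMING: NO
certificate is exhibited IN THIS FILE — it is the reduction (when it was written, at generation 5,
'κ₃ ≤ 73' was a manuscript-level candidate conditional on such a certificate). STATUS: the certificate
has since been PRODUCED, data-free, by the order-cell sweep and CHECKED by `decide +kernel` — 71 020 cells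
in 889 shards (`LaiSweepEngine … LaiSweepShard`, `LaiKappa3SweepS000 … S126`), packaged as
`Sweep.kappa3SweepCert` and mapped to a `Kappa3CellCert` by `Sweep.SweepCert.toCellCert`
(`LaiSweepKappa3.lean`) — so the conclusion below is the hypothesis-free tree theorem
`Sweep.kappa3_sweep_three_le_oddZetaSpanRank : 3 ≤ oddZetaSpanRank 36` (`LaiKappa3SweepCert.lean`).

## References

* [Lai2024BallRivoal] L. Lai, *Small improvements on the Ball–Rivoal theorem and its p-adic variant*,
  arXiv:2407.14236, §4 (4.5)–(4.6), Lemma 4.3 (the factor `Φ_n` and its arithmetic), Lemma 5.3 (its rate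
  `ϖ`). The point `(J, r, M; δ) = (74, 2180, 444; δ74)` is the family's (`LaiBoxInputs.lean`), not Lai's.
* [Zudilin2004] W. Zudilin, *Arithmetic of linear forms involving odd zeta values*, J. Théor. Nombres
  Bordeaux 16 (2004), §8 p. 270–271 (a finite cell table for `Φ_n`).
* [FischlerZudilin2010] S. Fischler, W. Zudilin, *A refinement of Nesterenko's linear independence
  criterion with applications to zeta values*, Math. Ann. 347 (2010), Thm 2.1 (the criterion behind
  `LaiBoxInputs.three_le_oddZetaSpanRank`).
-/

noncomputable section

open Finset Filter Topology

namespace Summit.KontsevichZagierPeriods.Zeta5Search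

/-- A κ₃ CERTIFICATE: a finite, pairwise disjoint, cell-by-cell admissible saving table for
`(J, r, M, δ, dmin) = (74, 2180, 444, δ74, 5)` whose truncated rate is `≥ 38700` and whose upper rate is
`≤ 80000`. [cite: Lai2024BallRivoal, Lemma 4.3, Lemma 5.3] -/
structure Kappa3CellCert where
  /-- the cells `[u, v)` with their exponents -/
  T : List SavingCell
  /-- truncation order of the densities `Σ_{k<K} (1/(k+u) − 1/(k+v))` -/
  K : ℕ
  /-- every cell lies in `[1/434, 1]` (`434 = M − 2 dmin`) and is non-empty -/
  wf : ∀ C ∈ T, C.WF 434 = true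
  /-- the cells are pairwise disjoint -/
  disj : CellsDisjoint T
  /-- every cell is admissible: its exponent is below the brick exponent on its class -/
  adm : ∀ C ∈ T, C.Adm 74 2180 444 δ74 5
  /-- the truncated rate reaches the margin of the κ₃ point -/
  lo : (38700 : ℚ) ≤ cellRateTrunc T K
  /-- the (crude) upper rate stays below the growth margin -/
  hi : cellRateUB T ≤ 80000

namespace Kappa3CellCert

variable (Γ : Kappa3CellCert)

/-- The table of a certificate is an admissible exponent table. [cite: Lai2024BallRivoal, §4 Lemma 4.3] -/
theorem admissible : LaiExpAdmissible 74 2180 444 δ74 5 (cellExp Γ.T) :=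
  laiExpAdmissible_cellExp 74 2180 444 δ74 5 Γ.T Γ.disj Γ.adm

/-- Its saving rate exists and is `cellRate T`. [cite: Lai2024BallRivoal, Lemma 5.3] -/
theorem savingRate :
    Tendsto (fun n : ℕ => Real.log ((laiPhiGen 74 444 5 (cellExp Γ.T) n : ℕ) : ℝ) / n) atTop
      (𝓝 (cellRate Γ.T)) :=
  tendsto_log_laiPhiGen_cellExp_div 74 444 5 (by norm_num) Γ.T (by simpa using Γ.wf)

/-- `38700 ≤ ϖ`. [folklore] -/
theorem lo_real : (38700 : ℝ) ≤ cellRate Γ.T := by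
  have h1 := cellRateTrunc_le Γ.T (lam := 434) (by norm_num) Γ.wf Γ.K
  have h2 : (((38700 : ℚ)) : ℝ) ≤ ((cellRateTrunc Γ.T Γ.K : ℚ) : ℝ) := by exact_mod_cast Γ.lo
  have h3 : (((38700 : ℚ)) : ℝ) = 38700 := by norm_num
  linarith

/-- `ϖ ≤ 80000`. [folklore] -/
theorem hi_real : cellRate Γ.T ≤ 80000 := by
  have h1 := cellRate_le_UB Γ.T (lam := 434) (by norm_num) Γ.wf
  have h2 : ((cellRateUB Γ.T : ℚ) : ℝ) ≤ (((80000 : ℚ)) : ℝ) := by exact_mod_cast Γ.hi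
  have h3 : (((80000 : ℚ)) : ℝ) = 80000 := by norm_num
  linarith

/-- The skeleton of the κ₃ point, filled from a certificate. [cite: Lai2024BallRivoal, Lemma 4.3, Lemma 5.3] -/
def laiBoxInputs : LaiBoxInputs 74 2180 444 δ74 36 :=
  kappa3LaiBoxInputs (cellExp Γ.T) Γ.admissible (cellRate Γ.T) Γ.savingRate Γ.lo_real Γ.hi_real

end Kappa3CellCert

/-- **'κ₃ ≤ 73' from a finite certificate.** Any admissible, disjoint cell table for the point
`(74, 2180, 444, δ74)` with truncated rate `≥ 38700` and upper rate `≤ 80000` gives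
`3 ≤ oddZetaSpanRank 36`, i.e. `dim_ℚ Span(1, ζ(3), …, ζ(73)) ≥ 3`. This is the reduction; the table is
exhibited downstream (`Sweep.kappa3SweepCert` via `Sweep.SweepCert.toCellCert`), which makes the conclusion
the hypothesis-free theorem `Sweep.kappa3_sweep_three_le_oddZetaSpanRank`. [cite: Lai2024BallRivoal, Lemma 5.3] -/
theorem kappa3_three_le_oddZetaSpanRank_of_cellCert (Γ : Kappa3CellCert) : 3 ≤ oddZetaSpanRank 36 :=
  kappa3_three_le_oddZetaSpanRank_of_savingRate (cellExp Γ.T) Γ.admissible (cellRate Γ.T) Γ.savingRate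
    Γ.lo_real Γ.hi_real

/-- The ladder reading: a certificate gives `3 ≤ oddZetaSpanRank m'` for every `m' ≥ 36`.
[cite: FischlerZudilin2010, Thm 2.1] -/
theorem kappa3_three_le_oddZetaSpanRank_le_of_cellCert (Γ : Kappa3CellCert) {m' : ℕ} (hm' : 36 ≤ m') :
    3 ≤ oddZetaSpanRank m' :=
  kappa3_three_le_oddZetaSpanRank_le (cellExp Γ.T) Γ.admissible (cellRate Γ.T) Γ.savingRate Γ.lo_real
    Γ.hi_real hm'

end Summit.KontsevichZagierPeriods.Zeta5Search

end
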